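/-
Copyright: the b2b-balaban T⁴-continuum CRUX team, row NE7b OWNER lineage `t4-ne7b-p1` (gen 144). Project licence.
-/
import Summits.QuantumFields.BalabanUV.T4Continuum.Spine.NE7b.SupHessWDerivFDeriv

/-!
# THE ENTRIES OF `P(ψ₀)` AT BASIS VECTORS (the `C⁵` repackaging, SCOPING-d16 §B (B)→(C); the order-5 companion of (533)
# `third_form_clm_fderiv_entry`).  (639) produced the Fréchet derivative of (533)'s order-4 object `Q` in COMPOSED form,
#   `P(ψ₀) = Σ_{x,y,z} (L ↦ L·b_{xyz}) ∘ (Σ_n (fderiv g_{n;xyz} ψ₀)·proj_n)`,  `g_{n;xyz}(ψ) = fderiv(T(·)[e_x,e_y,e_z])ψ[e_n]`.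
# Here: its entries are the second background-derivatives of the third-derivative entries,
#   `P(ψ₀)[e_s][e_n][e_x₀,e_y₀,e_z₀] = fderiv g_{n;x₀y₀z₀} ψ₀ [e_s]`
# — pure finite-dimensional bookkeeping (`proj_i(e_j) = δ_ij`, (533) `proj_single`), valid for ANY potential data (no
# hypothesis on `U` is used: the identity is about the composed linear algebra only) (row NE7b, node U5c; (533) BY NAME; [folklore]).  USE
# ((535)′): with (532) `fderiv_third_form_apply` at every `ψ` (`g_{n;xyz} =` (521)'s centred display) and `DifferentiableAt.lineDeriv_eq_fderiv`
# ((637)), the right-hand side is the `lineDeriv` that (600) `whitened_fifth_kernel_letter` and (610) `whitened_fifth_kernel_entry` bound.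

Cell `pub-balaban`, sub-cell `t4`, spine estimate NE7b (`T4WeightBudget.RelWeightBound`; the cell's OWN estimate — NOT PRINTED in
[Bałaban 1983–89], NOT PROVED).  Crux-route work under `Spine/NE7b/` by the row OWNER (`t4-ne7b-p1` gen 144, file (640)) under FREEZE
(0)'s crux-prover clause; NOTHING of Bałaban's is named as a Lean object, valued or asserted; no `T4Continuum/Support` leaf typed; no
`def`, no notation (`P` WRITTEN OUT); zero `sorry`.  Imports (BY NAME): the OWNER's (533) `…SupHessWDerivFDeriv` (`proj_single`).

WHAT IS PROVED ([folklore]): **`fourth_form_clm_fderiv_entry`**; toy.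

HONEST (what this is NOT).  An identity of finite sums; the conversion of its right-hand side to (600)∕(610)'s `lineDeriv` of the centred
display, the continuity of `P` and the order-5 packaging ((535)′) are NOT here; scalar skeleton ((A3), NC-NE7b-α UNRULED); nothing of
Bałaban's asserted.  BY-NAME EFFECT ON THE WALL: NONE.  NE7b NOT PRINTED ∕ NOT PROVED; spine PROVED 0∕9; rung (B)+1 — the programme's
measures remain FINITE-torus statements; NOT the mass gap, NOT Clay.  HONEST DEPENDENCY: continuum YM on T⁴ ⇐ BetaPertH ∧ nine spine
estimates (0∕9 proved); BetaPertH ⇐ (D1) ∧ (D4) ∧ CAP+tail; G-an2-4 gates asym, D1 and NE2∕3∕4.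
-/

set_option autoImplicit false
set_option maxSynthPendingDepth 4

noncomputable section

namespace Summit.QuantumFields.BalabanUV.T4Continuum.NE7b.SupFourthFormCLMEntry

open MeasureTheory ProbabilityTheory Finset Real Matrix
open SupHessWDerivFDeriv (proj_single)

variable {ι : Type} [Fintype ι] [DecidableEq ι]

section Main

variable {Γ : Matrix ι ι ℝ} {U : EuclideanSpace ℝ ι → ℝ} {U' : EuclideanSpace ℝ ι → EuclideanSpace ℝ ι →L[ℝ] ℝ}
  {U'' : EuclideanSpace ℝ ι → EuclideanSpace ℝ ι →L[ℝ] EuclideanSpace ℝ ι →L[ℝ] ℝ}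
  {U₃ : EuclideanSpace ℝ ι → EuclideanSpace ℝ ι →L[ℝ] EuclideanSpace ℝ ι →L[ℝ] EuclideanSpace ℝ ι →L[ℝ] ℝ}

set_option maxHeartbeats 4000000 in
/-- **THE ENTRIES OF `P(ψ₀)`**: `P(ψ₀)[e_s][e_n][e_x₀,e_y₀,e_z₀] = fderiv (ψ ↦ fderiv(T(·)[e_x₀,e_y₀,e_z₀])ψ[e_n]) ψ₀ [e_s]`. [folklore] -/
theorem fourth_form_clm_fderiv_entry (ψ₀ : EuclideanSpace ℝ ι) (s n x₀ y₀ z₀ : ι) :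
    (∑ x, ∑ y, ∑ z, ((ContinuousLinearMap.smulRightL ℝ (EuclideanSpace ℝ ι) (EuclideanSpace ℝ ι →L[ℝ] EuclideanSpace ℝ ι →L[ℝ] EuclideanSpace ℝ ι
        →L[ℝ] ℝ)).flip ((EuclideanSpace.proj x : EuclideanSpace ℝ ι →L[ℝ] ℝ).smulRight ((EuclideanSpace.proj y : EuclideanSpace ℝ ι →L[ℝ]
        ℝ).smulRight (EuclideanSpace.proj z : EuclideanSpace ℝ ι →L[ℝ] ℝ)))).comp (∑ n : ι, (fderiv ℝ (fun ψ : EuclideanSpace ℝ ι => (fderiv ℝ (fun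
        ψ' : EuclideanSpace ℝ ι => ((∫ ω : EuclideanSpace ℝ ι, exp (-U (ω + ψ')) ∂(multivariateGaussian 0 Γ)))⁻¹ * (∫ ω : EuclideanSpace ℝ ι, exp
        (-U (ω + ψ')) * (U₃ (ω + ψ') (EuclideanSpace.single x (1 : ℝ)) (EuclideanSpace.single y (1 : ℝ)) (EuclideanSpace.single z (1 : ℝ)) - U' (ω +
        ψ') (EuclideanSpace.single y (1 : ℝ)) * U'' (ω + ψ') (EuclideanSpace.single x (1 : ℝ)) (EuclideanSpace.single z (1 : ℝ)) - U'' (ω + ψ')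
        (EuclideanSpace.single x (1 : ℝ)) (EuclideanSpace.single y (1 : ℝ)) * U' (ω + ψ') (EuclideanSpace.single z (1 : ℝ)) - U' (ω + ψ')
        (EuclideanSpace.single x (1 : ℝ)) * U'' (ω + ψ') (EuclideanSpace.single y (1 : ℝ)) (EuclideanSpace.single z (1 : ℝ)) + U' (ω + ψ')
        (EuclideanSpace.single x (1 : ℝ)) * U' (ω + ψ') (EuclideanSpace.single y (1 : ℝ)) * U' (ω + ψ') (EuclideanSpace.single z (1 : ℝ)))
        ∂(multivariateGaussian 0 Γ)) + ((∫ ω : EuclideanSpace ℝ ι, exp (-U (ω + ψ')) ∂(multivariateGaussian 0 Γ)) ^ 2)⁻¹ * (∫ ω : EuclideanSpace ℝ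
        ι, exp (-U (ω + ψ')) * U' (ω + ψ') (EuclideanSpace.single x (1 : ℝ)) ∂(multivariateGaussian 0 Γ)) * (∫ ω : EuclideanSpace ℝ ι, exp (-U (ω +
        ψ')) * (U'' (ω + ψ') (EuclideanSpace.single y (1 : ℝ)) (EuclideanSpace.single z (1 : ℝ)) - U' (ω + ψ') (EuclideanSpace.single y (1 : ℝ)) *
        U' (ω + ψ') (EuclideanSpace.single z (1 : ℝ))) ∂(multivariateGaussian 0 Γ)) + ((∫ ω : EuclideanSpace ℝ ι, exp (-U (ω + ψ'))
        ∂(multivariateGaussian 0 Γ)) ^ 2)⁻¹ * (∫ ω : EuclideanSpace ℝ ι, exp (-U (ω + ψ')) * U' (ω + ψ') (EuclideanSpace.single y (1 : ℝ))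
        ∂(multivariateGaussian 0 Γ)) * (∫ ω : EuclideanSpace ℝ ι, exp (-U (ω + ψ')) * (U'' (ω + ψ') (EuclideanSpace.single x (1 : ℝ))
        (EuclideanSpace.single z (1 : ℝ)) - U' (ω + ψ') (EuclideanSpace.single x (1 : ℝ)) * U' (ω + ψ') (EuclideanSpace.single z (1 : ℝ)))
        ∂(multivariateGaussian 0 Γ)) + (((∫ ω : EuclideanSpace ℝ ι, exp (-U (ω + ψ')) ∂(multivariateGaussian 0 Γ)) ^ 2)⁻¹ * (∫ ω : EuclideanSpace ℝ
        ι, exp (-U (ω + ψ')) * (U'' (ω + ψ') (EuclideanSpace.single x (1 : ℝ)) (EuclideanSpace.single y (1 : ℝ)) - U' (ω + ψ')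
        (EuclideanSpace.single x (1 : ℝ)) * U' (ω + ψ') (EuclideanSpace.single y (1 : ℝ))) ∂(multivariateGaussian 0 Γ)) + -2 / (∫ ω : EuclideanSpace
        ℝ ι, exp (-U (ω + ψ')) ∂(multivariateGaussian 0 Γ)) ^ 3 * -(∫ ω : EuclideanSpace ℝ ι, exp (-U (ω + ψ')) * U' (ω + ψ') (EuclideanSpace.single
        x (1 : ℝ)) ∂(multivariateGaussian 0 Γ)) * (∫ ω : EuclideanSpace ℝ ι, exp (-U (ω + ψ')) * U' (ω + ψ') (EuclideanSpace.single y (1 : ℝ))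
        ∂(multivariateGaussian 0 Γ))) * (∫ ω : EuclideanSpace ℝ ι, exp (-U (ω + ψ')) * U' (ω + ψ') (EuclideanSpace.single z (1 : ℝ))
        ∂(multivariateGaussian 0 Γ))) ψ) (EuclideanSpace.single n (1 : ℝ))) ψ₀).smulRight (EuclideanSpace.proj n : EuclideanSpace ℝ ι →L[ℝ] ℝ)))
        (EuclideanSpace.single s (1 : ℝ)) (EuclideanSpace.single n (1 : ℝ)) (EuclideanSpace.single x₀ (1 : ℝ)) (EuclideanSpace.single y₀ (1 : ℝ))
        (EuclideanSpace.single z₀ (1 : ℝ)) = fderiv ℝ (fun ψ : EuclideanSpace ℝ ι => (fderiv ℝ (fun ψ' : EuclideanSpace ℝ ι => ((∫ ω :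
        EuclideanSpace ℝ ι, exp (-U (ω + ψ')) ∂(multivariateGaussian 0 Γ)))⁻¹ * (∫ ω : EuclideanSpace ℝ ι, exp (-U (ω + ψ')) * (U₃ (ω + ψ')
        (EuclideanSpace.single x₀ (1 : ℝ)) (EuclideanSpace.single y₀ (1 : ℝ)) (EuclideanSpace.single z₀ (1 : ℝ)) - U' (ω + ψ')
        (EuclideanSpace.single y₀ (1 : ℝ)) * U'' (ω + ψ') (EuclideanSpace.single x₀ (1 : ℝ)) (EuclideanSpace.single z₀ (1 : ℝ)) - U'' (ω + ψ')
        (EuclideanSpace.single x₀ (1 : ℝ)) (EuclideanSpace.single y₀ (1 : ℝ)) * U' (ω + ψ') (EuclideanSpace.single z₀ (1 : ℝ)) - U' (ω + ψ')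
        (EuclideanSpace.single x₀ (1 : ℝ)) * U'' (ω + ψ') (EuclideanSpace.single y₀ (1 : ℝ)) (EuclideanSpace.single z₀ (1 : ℝ)) + U' (ω + ψ')
        (EuclideanSpace.single x₀ (1 : ℝ)) * U' (ω + ψ') (EuclideanSpace.single y₀ (1 : ℝ)) * U' (ω + ψ') (EuclideanSpace.single z₀ (1 : ℝ)))
        ∂(multivariateGaussian 0 Γ)) + ((∫ ω : EuclideanSpace ℝ ι, exp (-U (ω + ψ')) ∂(multivariateGaussian 0 Γ)) ^ 2)⁻¹ * (∫ ω : EuclideanSpace ℝ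
        ι, exp (-U (ω + ψ')) * U' (ω + ψ') (EuclideanSpace.single x₀ (1 : ℝ)) ∂(multivariateGaussian 0 Γ)) * (∫ ω : EuclideanSpace ℝ ι, exp (-U (ω +
        ψ')) * (U'' (ω + ψ') (EuclideanSpace.single y₀ (1 : ℝ)) (EuclideanSpace.single z₀ (1 : ℝ)) - U' (ω + ψ') (EuclideanSpace.single y₀ (1 : ℝ))
        * U' (ω + ψ') (EuclideanSpace.single z₀ (1 : ℝ))) ∂(multivariateGaussian 0 Γ)) + ((∫ ω : EuclideanSpace ℝ ι, exp (-U (ω + ψ'))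
        ∂(multivariateGaussian 0 Γ)) ^ 2)⁻¹ * (∫ ω : EuclideanSpace ℝ ι, exp (-U (ω + ψ')) * U' (ω + ψ') (EuclideanSpace.single y₀ (1 : ℝ))
        ∂(multivariateGaussian 0 Γ)) * (∫ ω : EuclideanSpace ℝ ι, exp (-U (ω + ψ')) * (U'' (ω + ψ') (EuclideanSpace.single x₀ (1 : ℝ))
        (EuclideanSpace.single z₀ (1 : ℝ)) - U' (ω + ψ') (EuclideanSpace.single x₀ (1 : ℝ)) * U' (ω + ψ') (EuclideanSpace.single z₀ (1 : ℝ)))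
        ∂(multivariateGaussian 0 Γ)) + (((∫ ω : EuclideanSpace ℝ ι, exp (-U (ω + ψ')) ∂(multivariateGaussian 0 Γ)) ^ 2)⁻¹ * (∫ ω : EuclideanSpace ℝ
        ι, exp (-U (ω + ψ')) * (U'' (ω + ψ') (EuclideanSpace.single x₀ (1 : ℝ)) (EuclideanSpace.single y₀ (1 : ℝ)) - U' (ω + ψ')
        (EuclideanSpace.single x₀ (1 : ℝ)) * U' (ω + ψ') (EuclideanSpace.single y₀ (1 : ℝ))) ∂(multivariateGaussian 0 Γ)) + -2 / (∫ ω :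
        EuclideanSpace ℝ ι, exp (-U (ω + ψ')) ∂(multivariateGaussian 0 Γ)) ^ 3 * -(∫ ω : EuclideanSpace ℝ ι, exp (-U (ω + ψ')) * U' (ω + ψ')
        (EuclideanSpace.single x₀ (1 : ℝ)) ∂(multivariateGaussian 0 Γ)) * (∫ ω : EuclideanSpace ℝ ι, exp (-U (ω + ψ')) * U' (ω + ψ')
        (EuclideanSpace.single y₀ (1 : ℝ)) ∂(multivariateGaussian 0 Γ))) * (∫ ω : EuclideanSpace ℝ ι, exp (-U (ω + ψ')) * U' (ω + ψ')
        (EuclideanSpace.single z₀ (1 : ℝ)) ∂(multivariateGaussian 0 Γ))) ψ) (EuclideanSpace.single n (1 : ℝ))) ψ₀ (EuclideanSpace.single s (1 : ℝ))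
        := by
  simp only [FunLike.coe_sum, Finset.sum_apply, ContinuousLinearMap.coe_comp, Function.comp_apply,
    ContinuousLinearMap.flip_apply, ContinuousLinearMap.smulRightL_apply_apply, ContinuousLinearMap.smulRight_apply, FunLike.coe_smul,
    Pi.smul_apply, proj_single, smul_eq_mul, mul_ite, mul_one, mul_zero, Finset.sum_ite_eq', Finset.mem_univ, if_true]

end Main

/-! ## Toy -/

/-- Toy (the bookkeeping): `Σ_m c_m·δ_{mn} = c_n` over a finite index type. -/
example (c : ι → ℝ) (n : ι) : ∑ m, c m * (if m = n then 1 else 0) = c n := by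
  simp [mul_ite, Finset.sum_ite_eq']

end Summit.QuantumFields.BalabanUV.T4Continuum.NE7b.SupFourthFormCLMEntry

end
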